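import Literature.MathematicalPhysics.QuantumFieldTheory.Balaban1983to89.B9LocalCubeGeometryTwoLevelWindowY
import Literature.MathematicalPhysics.QuantumFieldTheory.Balaban1983to89.B6TranslateTorusV1

/-!
# `Balaban1983to89.B9LocalCubeGeometryChartY` — T. Bałaban, *Propagators for lattice gauge theories in a background field*, Commun. Math. Phys. **99** (1985)
# 389–434 [Balaban1985BackgroundPropagators], p. 408 («□̃») and the proof of Thm 3.11 p. 416 («G_□(1) is positive», from [4] = [Balaban1984PropagatorsII], p. 238 «we take the
# cube □̃³ and identify it with a torus T_□», (2.89) p. 239, (2.36) p. 229): **EVERY ENLARGED CUBE `□̃(c)` OF THE COVER SITS ONE BIG BLOCK OFF THE SEAM IN A SUITABLE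
# CHART OF THE TORUS** — the label margins of row 17's local road (`hmargS`, `hmargT` of `Summits/…/BalabanUVNodesN06Row17LocalCentreEveryCube`) DISCHARGED in the frame
# of p21's chart `s(c)` for every cover cube at every member

Statement-level skeleton with citation tags; proofs where landed; nothing here is a claim about the Yang–Mills mass gap.

THE PRINT.  [4] p. 238: *«Let us consider the term h_□Δ_a h_□ … we take the cube □̃³ and identify it with a torus T_□ … the operators … are defined on T_□ as in (2.19)»*;
p. 229: *«cubes □ of the size 2ML^jη, each cube being a sum of 2^d big blocks with a center y ∈ Λ_j»*; (2.36): *«M ≥ 8»* big blocks; [B9] p. 408: *«□̃ … sum of □ and the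
neighboring cubes»*.

WHY THIS FILE (cell context, 2026-08-28).  Row 17's `hco` binder at `U = 1` and `hloc(U)` on (3.35) are theorems for EVERY enlarged cube `□̃(c) = cubeDomY x c`
(`…Row17LocalCentreEveryCube`, g26) GIVEN the label margins «one big block off the box boundary» for the `Λ_j`-blocks inside `□̃(c)` and the `Λ_{j+1}`-blocks one step
around it; in the GLOBAL chart these margins FAIL for the cubes meeting its seam.  This seat's `B6SectALemma24TwoLevelV1SitesChart` ∕ `B9LocalLemma24TwoLevelCollarChartY`
(g27) accept the margins in the frame of ANY chart `s` of the torus (translation by `(M·L^k)·s`, r03's `B6TranslateV1` covariance); THIS FILE PRODUCES THE CHART for every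
cube: below the top level p38's canonical chart (`s_μ = β_μ ∕ L^{k−j(c)} − 2`: the cube's big block becomes the block of index `β mod L^{k−j(c)} + 2L^{k−j(c)}` of its level,
so the centre sits in `[2S_k + S∕2, 3S_k − S∕2]`); for a TOP cube the placement `KIdx.hpl` (`B6CubeWindowV1.Placed`) forces `P′_μ ≥ 2L ≥ 10` big blocks per direction and the
chart `s_μ = β_μ − ⌊P′_μ∕2⌋` puts the centre at `(⌊P′_μ∕2⌋ + ½)S_k`.  In either chart every site of `□̃(c)` (within `15S∕4` of the centre modulo the period, g26's
`exists_abs_sub_ctr_le_of_mem_cubeDomY`) has translated labels in `[S∕2, N₀ − S∕2]`, and `S ≥ 8L^{j(c)+1}` (`M_h ≥ 8`) leaves the margins.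
* §1 `exists_val_sub_tv_zero` (labels of a translated fine site), `sub_tv_mem_iterBlock` (blocks go to blocks), `val_mul_pow_le_of_mem_iterBlock` (corner ≤ site < corner + Lⁿ),
  `eight_pow_le_bigSide` (`8Lⁿ ≤ S` for `n ≤ j(c)+1`), `ten_le_P_of_top` (a top cube forces `P′ ≥ 10`).
* §2 ★ `central_of_chart` (a chart whose centre offset `C_μ` satisfies `15S∕4 ≤ C_μ`, `C_μ + 19S∕4 ≤ N₀_μ` puts every translated site of `□̃(c)` in `[S∕2, N₀ − S∕2]`),
  ★★ `exists_chart_central` (such a chart exists for every cube: the two cases above).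
* §3 ★★ `margins_of_central` (translated labels in `[S∕2, N₀ − S∕2]` ⇒ the margins `hmargS`∕`hmargT` of the chart road at both candidate levels `j ∈ {j(c)−1, j(c)}`),
  ★★★ **`exists_chart_margins_cubeDomY`**: for EVERY member `x`, EVERY cover cube `c` and `j + 1 ≤ k` with `j = j(c) ∨ j + 1 = j(c)` a chart `s` with BOTH margins in the
  binder shapes of `B9LocalLemma24TwoLevelCollarChartY.local_lemma24_real_twoLevel_of_lev_chart` at `D := cubeDomY x c`.
IMPORTS `B9LocalCubeGeometryTwoLevelWindowY` (g26, p671344), `B6TranslateTorusV1` (r03); nothing restated.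
HONEST SCOPE.  Lattice bookkeeping over landed dictionaries (p38's canonical chart, r03's translation vectors, `KIdx.hpl`∕`hM8`∕`hP5`); no estimate of [B9]∕[4]; NOT a node
discharge; count-neutral; one finite 𝕋⁴ programme — nothing continuum ∕ OS ∕ mass gap ∕ Clay.  Cell `pub-ymgap` (D-0062), node N06 [B9] × N10 ROAD «C», seat
`pub-ymgap-dag-n06-j` gen 27, 2026-08-28.  No `sorry`∕`axiom`∕`instance`∕`def`.
-/

noncomputable section

namespace Literature.MathematicalPhysics.QuantumFieldTheory.Balaban1983to89.B9LocalCubeGeometryChartY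

open Literature.MathematicalPhysics.QuantumFieldTheory.Balaban1983to89
open Literature.MathematicalPhysics.QuantumFieldTheory.Balaban1983to89.Node00
open Literature.MathematicalPhysics.QuantumFieldTheory.Balaban1983to89.B6KLevelCensusIndexV1 (KIdx)
open Literature.MathematicalPhysics.QuantumFieldTheory.Balaban1983to89.B6GlobalChartV1 (PV boxEquiv toBox toBox_apply domT)
open Literature.MathematicalPhysics.QuantumFieldTheory.Balaban1983to89.B6MultiLevelBoxOperator (N0 bigSide one_le_bigSide Domains)
open Literature.MathematicalPhysics.QuantumFieldTheory.Balaban1983to89.B6MultiLevelTorusOperator (TDomains N0_eq_bigSide_mul)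
open Literature.MathematicalPhysics.QuantumFieldTheory.Balaban1983to89.B6Eq238MultiLevelTorus (rj qc one_le_rj bigSide_k_eq)
open Literature.MathematicalPhysics.QuantumFieldTheory.Balaban1983to89.B6CubeWindowV1 (Placed)
open Literature.MathematicalPhysics.QuantumFieldTheory.Balaban1983to89.B6Cover236MultiLevelBlocks (cubes)
open Literature.MathematicalPhysics.QuantumFieldTheory.Balaban1983to89.B6Partition118KLevelTorusCentral (level_bounds)
open Literature.MathematicalPhysics.QuantumFieldTheory.Balaban1983to89.B6MemberOfCubeV1 (one_le_N0)
open Literature.MathematicalPhysics.QuantumFieldTheory.Balaban1983to89.B6TranslateV1 (tv tv_apply tv_zero_apply tv_neg iterBlockOf_add_tv)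
open Literature.MathematicalPhysics.QuantumFieldTheory.Balaban1983to89.B6TranslateTorusV1 (dvd_tvec)
open Literature.MathematicalPhysics.QuantumFieldTheory.Balaban1983to89.B5Eq118OneStroke (iterBlock iterBlockOf mem_iterBlock mem_iterBlock_iff)
open Literature.MathematicalPhysics.QuantumFieldTheory.Balaban1983to89.B9PinMembersKLevelV1 (MemberY)
open Literature.MathematicalPhysics.QuantumFieldTheory.Balaban1983to89.B9WalkLettersCoordsS (cubeDomY)
open Literature.MathematicalPhysics.QuantumFieldTheory.Balaban1983to89.B9LocalCubeGeometryOneLevelY (chartY_eq_toBox)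
open Literature.MathematicalPhysics.QuantumFieldTheory.Balaban1983to89.B9LocalCubeGeometryTwoLevelWindowY (exists_abs_sub_ctr_le_of_mem_cubeDomY bigSide_pos)
open Literature.MathematicalPhysics.QuantumFieldTheory.Balaban1983to89.Node00.OpsYNablaBridge (chartY)
open Literature.MathematicalPhysics.QuantumFieldTheory.Balaban1983to89.B9Thm37CubeCoverCommutators (one_le_Mh_and_P)

variable {d ℓ : ℕ} {hd : 1 ≤ d + 1} {hL : Odd (ℓ + 1) ∧ 1 < ℓ + 1} {b₀ b₁ : ℝ} {Mstar : ℕ}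
variable (x : MemberY d ℓ hd hL b₀ b₁ Mstar) (c : ↥(cubes x.toKIdx.D.toDomains))

/-! ## §1 Labels of translated sites and blocks; the member's numerals -/

/-- coordinates of a difference of sites. [folklore] -/
private theorem site_sub_apply {n : ℕ} (y t : Site (PV d ℓ x.m x.K hd hL) n) (μ : Fin (d + 1)) : (y - t) μ = y μ - t μ := rfl

/-- `N₀ = N_n · Lⁿ` (the fine period against the level-`n` period). [cite: Balaban1984PropagatorsI, (1.6) p.18; folklore] -/
private theorem sitesPerDir_zero_eq_mul' {n : ℕ} (hn : n ≤ x.m + x.K) :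
    (PV d ℓ x.m x.K hd hL).sitesPerDir 0 = (PV d ℓ x.m x.K hd hL).sitesPerDir n * (ℓ + 1) ^ n := by
  show 2 * (ℓ + 1) ^ (x.m + x.K - 0) = 2 * (ℓ + 1) ^ (x.m + x.K - n) * (ℓ + 1) ^ n
  rw [Nat.sub_zero, mul_assoc, ← pow_add, Nat.sub_add_cancel hn]

/-- **labels of a translated fine site**: `((x − v) mod N₀)_μ = x_μ − v_μ + N₀·m` for some integer `m`. [cite: Balaban1983RegularityDecay, p.572 («T_η … periodic conditions»); folklore] -/
theorem exists_val_sub_tv_zero (v : Fin (d + 1) → ℤ) (xx : Site (PV d ℓ x.m x.K hd hL) 0) (μ : Fin (d + 1)) :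
    ∃ m : ℤ, ((((xx - tv (PV d ℓ x.m x.K hd hL) v 0) μ).val : ℕ) : ℤ) = (((xx μ).val : ℕ) : ℤ) - v μ + ((PV d ℓ x.m x.K hd hL).sitesPerDir 0 : ℤ) * m := by
  have h : (((((xx - tv (PV d ℓ x.m x.K hd hL) v 0) μ).val : ℕ) : ℤ) : ZMod ((PV d ℓ x.m x.K hd hL).sitesPerDir 0)) =
      (((((xx μ).val : ℕ) : ℤ) - v μ : ℤ) : ZMod ((PV d ℓ x.m x.K hd hL).sitesPerDir 0)) := by
    push_cast
    rw [ZMod.natCast_zmod_val, ZMod.natCast_zmod_val, site_sub_apply, tv_zero_apply]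
  obtain ⟨m, hm⟩ := (ZMod.intCast_eq_intCast_iff_dvd_sub _ _ _).1 h.symm
  exact ⟨m, by linarith⟩

/-- **blocks go to blocks**: if `xx ∈ Bⁿ(y)` then `xx − v ∈ Bⁿ(y − v∕Lⁿ)` (`Lⁿ ∣ v`, `n ≤ m + K`). [cite: Balaban1984PropagatorsI, (1.6) p.18; Balaban1984PropagatorsII, (2.1) p.224; folklore] -/
theorem sub_tv_mem_iterBlock {n : ℕ} (hn : n ≤ x.m + x.K) {v : Fin (d + 1) → ℤ} (hv : ∀ μ, ((ℓ + 1 : ℕ) : ℤ) ^ n ∣ v μ)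
    {y : Site (PV d ℓ x.m x.K hd hL) n} {xx : Site (PV d ℓ x.m x.K hd hL) 0} (h : xx ∈ iterBlock n y) :
    xx - tv (PV d ℓ x.m x.K hd hL) v 0 ∈ iterBlock n (y - tv (PV d ℓ x.m x.K hd hL) v n) := by
  rw [mem_iterBlock] at h ⊢
  have hv' : ∀ μ, (((PV d ℓ x.m x.K hd hL).L : ℤ) ^ n) ∣ (-v) μ := fun μ => by rw [Pi.neg_apply]; exact (hv μ).neg_right
  have hv0 : ∀ μ, (((PV d ℓ x.m x.K hd hL).L : ℤ) ^ 0) ∣ v μ := fun μ => by rw [pow_zero]; exact one_dvd _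
  have e := iterBlockOf_add_tv n hn hv' xx
  rw [tv_neg _ _ hv0, tv_neg _ _ hv, h] at e
  rw [sub_eq_add_neg, sub_eq_add_neg]
  exact e

/-- **corner ≤ site < corner + Lⁿ** for a fine site of `Bⁿ(y)`: `y_μ·Lⁿ ≤ x_μ < y_μ·Lⁿ + Lⁿ` on the labels. [cite: Balaban1984PropagatorsI, (1.6) p.18; folklore] -/
theorem val_mul_pow_le_of_mem_iterBlock {n : ℕ} (hn : n ≤ x.m + x.K) {y : Site (PV d ℓ x.m x.K hd hL) n} {xx : Site (PV d ℓ x.m x.K hd hL) 0}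
    (h : xx ∈ iterBlock n y) (μ : Fin (d + 1)) : (y μ).val * (ℓ + 1) ^ n ≤ (xx μ).val ∧ (xx μ).val < (y μ).val * (ℓ + 1) ^ n + (ℓ + 1) ^ n := by
  have h' : (xx μ).val / (ℓ + 1) ^ n = (y μ).val := (mem_iterBlock_iff hn y xx).1 h μ
  have hLn : 0 < (ℓ + 1) ^ n := pow_pos (Nat.succ_pos ℓ) n
  rw [← h']
  exact ⟨Nat.div_mul_le_self _ _, Nat.lt_div_mul_add hLn⟩

/-- `8Lⁿ ≤ S = M_h L^{j(c)+1}` for `n ≤ j(c) + 1` (`M_h ≥ 8`). [cite: Balaban1984PropagatorsII, (2.36) p.229 (M ≥ 8 big blocks), bookkeeping] -/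
theorem eight_pow_le_bigSide {n : ℕ} (hn : n ≤ c.1.1 + 1) : 8 * (ℓ + 1) ^ n ≤ bigSide ℓ x.toKIdx.Mh c.1.1 := by
  unfold bigSide
  exact Nat.mul_le_mul x.toKIdx.hM8 (Nat.pow_le_pow_right (Nat.succ_pos ℓ) hn)

/-- **A TOP CUBE FORCES `P′_μ ≥ 10`**: the placement `KIdx.hpl` of a cube of level `k` in the canonical chart reads `2 − ℓ∕2 + 2L ≤ P′_μ` with `ℓ ≥ 4`.
[cite: Balaban1984PropagatorsII, p.229, p.238 (charts); bookkeeping over `B6CubeWindowV1.Placed`] -/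
theorem ten_le_P_of_top (htop : c.1.1 = x.toKIdx.k) (μ : Fin (d + 1)) : 10 ≤ x.toKIdx.P' μ := by
  have hpl := x.toKIdx.hpl c μ
  have hr : rj ℓ x.toKIdx.k c.1.1 = 1 := by unfold rj; rw [htop, Nat.sub_self, pow_zero]
  have hq : qc ℓ x.toKIdx.k c.1.1 c.1.2 μ = 2 := by unfold qc; rw [hr]; simp
  rw [hq, hr] at hpl
  have hℓ : (4 : ℤ) ≤ ℓ := by exact_mod_cast x.toKIdx.hℓ
  have h2 := hpl.2
  push_cast at h2
  have : (10 : ℤ) ≤ x.toKIdx.P' μ := by omega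
  exact_mod_cast this

/-! ## §2 A chart of the torus in which `□̃(c)` sits in `[S∕2, N₀ − S∕2]` -/

/-- ★ **A WELL-PLACED CHART PUTS `□̃(c)` IN `[S∕2, N₀ − S∕2]`.**  If the chart `s` moves the cube centre to `C_μ + S∕2` with `15S∕4 ≤ C_μ` and `C_μ + 19S∕4 ≤ N₀_μ`
(`(β_μ + ½)S − S_k·s_μ = C_μ + S∕2`), then every site of `□̃(c)` — within `15S∕4 − 1` of the centre modulo the period — has translated labels `t` with `S ≤ 2t` and
`2t + S ≤ 2N₀`. [cite: Balaban1984PropagatorsII, p.238 (T_□), p.229, (2.36); Balaban1985BackgroundPropagators, p.408 (□̃); bookkeeping] -/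
theorem central_of_chart (s : Fin (d + 1) → ℤ) (C : Fin (d + 1) → ℝ)
    (hC : ∀ μ, ((c.1.2 μ : ℝ) + 1 / 2) * (bigSide ℓ x.toKIdx.Mh c.1.1 : ℝ) - (bigSide ℓ x.toKIdx.Mh x.toKIdx.k : ℝ) * (s μ : ℝ) =
      C μ + (bigSide ℓ x.toKIdx.Mh c.1.1 : ℝ) / 2)
    (hlo : ∀ μ, 15 / 4 * (bigSide ℓ x.toKIdx.Mh c.1.1 : ℝ) ≤ C μ)
    (hhi : ∀ μ, C μ + 19 / 4 * (bigSide ℓ x.toKIdx.Mh c.1.1 : ℝ) ≤ (N0 ℓ x.toKIdx.Mh x.toKIdx.k x.toKIdx.P' μ : ℝ))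
    {xx : Site (PV d ℓ x.m x.K hd hL) 0} (hxx : chartY x.toKIdx xx ∈ cubeDomY x c) (μ : Fin (d + 1)) :
    bigSide ℓ x.toKIdx.Mh c.1.1 ≤ 2 * ((xx - tv (PV d ℓ x.m x.K hd hL) (TDomains.tvec ℓ x.toKIdx.Mh x.toKIdx.k s) 0) μ).val ∧
      2 * ((xx - tv (PV d ℓ x.m x.K hd hL) (TDomains.tvec ℓ x.toKIdx.Mh x.toKIdx.k s) 0) μ).val + bigSide ℓ x.toKIdx.Mh c.1.1 ≤
        2 * (PV d ℓ x.m x.K hd hL).sitesPerDir 0 := by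
  have hNμ : N0 ℓ x.toKIdx.Mh x.toKIdx.k x.toKIdx.P' μ = (PV d ℓ x.m x.K hd hL).sitesPerDir 0 := x.toKIdx.hN μ
  -- the site is within `15S∕4 − 1` of the centre modulo the period
  obtain ⟨m, hm⟩ := exists_abs_sub_ctr_le_of_mem_cubeDomY x c hxx μ
  have hz : ((chartY x.toKIdx xx).1 μ : ℝ) = (((xx μ).val : ℕ) : ℝ) := by
    rw [chartY_eq_toBox, toBox_apply]; push_cast; rfl
  rw [hz, hNμ] at hm
  obtain ⟨hm1, hm2⟩ := abs_le.1 hm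
  -- the translated label `t = x_μ − S_k·s_μ + N₀·m′`
  obtain ⟨m', hm'⟩ := exists_val_sub_tv_zero x (TDomains.tvec ℓ x.toKIdx.Mh x.toKIdx.k s) xx μ
  have ht : ((((xx - tv (PV d ℓ x.m x.K hd hL) (TDomains.tvec ℓ x.toKIdx.Mh x.toKIdx.k s) 0) μ).val : ℕ) : ℝ) =
      (((xx μ).val : ℕ) : ℝ) - (bigSide ℓ x.toKIdx.Mh x.toKIdx.k : ℝ) * (s μ : ℝ) + ((PV d ℓ x.m x.K hd hL).sitesPerDir 0 : ℝ) * (m' : ℝ) := by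
    have e : TDomains.tvec ℓ x.toKIdx.Mh x.toKIdx.k s μ = (bigSide ℓ x.toKIdx.Mh x.toKIdx.k : ℤ) * s μ := rfl
    have h' := congrArg (fun z : ℤ => (z : ℝ)) hm'
    rw [e] at h'
    push_cast at h'
    linarith
  have ht0 : (0 : ℝ) ≤ ((((xx - tv (PV d ℓ x.m x.K hd hL) (TDomains.tvec ℓ x.toKIdx.Mh x.toKIdx.k s) 0) μ).val : ℕ) : ℝ) := Nat.cast_nonneg _
  have htN : ((((xx - tv (PV d ℓ x.m x.K hd hL) (TDomains.tvec ℓ x.toKIdx.Mh x.toKIdx.k s) 0) μ).val : ℕ) : ℝ) + 1 ≤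
      ((PV d ℓ x.m x.K hd hL).sitesPerDir 0 : ℝ) := by
    have hlt : ((xx - tv (PV d ℓ x.m x.K hd hL) (TDomains.tvec ℓ x.toKIdx.Mh x.toKIdx.k s) 0) μ).val + 1 ≤ (PV d ℓ x.m x.K hd hL).sitesPerDir 0 :=
      ZMod.val_lt _
    exact_mod_cast hlt
  have hCμ := hC μ
  have hloμ := hlo μ
  have hhiμ := hhi μ
  rw [hNμ] at hhiμ
  have hS0 : (0 : ℝ) < (bigSide ℓ x.toKIdx.Mh c.1.1 : ℝ) := bigSide_pos x c.1.1
  have hN0 : (0 : ℝ) < ((PV d ℓ x.m x.K hd hL).sitesPerDir 0 : ℝ) := by linarith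
  -- `t = C + S∕2 + δ + N₀·(m + m′)` with `|δ| ≤ 15S∕4 − 1`; both `t` and `C + S∕2 + δ` lie in `[0, N₀)`, so `m + m′ = 0`
  have hM0 : m + m' = 0 := by
    rcases lt_trichotomy (m + m') 0 with hneg | h0 | hpos
    · exfalso
      have hle : (m : ℝ) + (m' : ℝ) ≤ -1 := by exact_mod_cast (show m + m' ≤ -1 by omega)
      have hmul := mul_le_mul_of_nonneg_left hle hN0.le
      nlinarith [hmul]
    · exact h0
    · exfalso
      have hge : (1 : ℝ) ≤ (m : ℝ) + (m' : ℝ) := by exact_mod_cast (show 1 ≤ m + m' by omega)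
      have hmul := mul_le_mul_of_nonneg_left hge hN0.le
      nlinarith [hmul]
  have hmm : (m' : ℝ) = -(m : ℝ) := by
    have e : m' = -m := by omega
    rw [e]; push_cast; ring
  rw [hmm] at ht
  have key1 : (bigSide ℓ x.toKIdx.Mh c.1.1 : ℝ) ≤
      2 * ((((xx - tv (PV d ℓ x.m x.K hd hL) (TDomains.tvec ℓ x.toKIdx.Mh x.toKIdx.k s) 0) μ).val : ℕ) : ℝ) := by linarith
  have key2 : 2 * ((((xx - tv (PV d ℓ x.m x.K hd hL) (TDomains.tvec ℓ x.toKIdx.Mh x.toKIdx.k s) 0) μ).val : ℕ) : ℝ) +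
      (bigSide ℓ x.toKIdx.Mh c.1.1 : ℝ) ≤ 2 * ((PV d ℓ x.m x.K hd hL).sitesPerDir 0 : ℝ) := by linarith
  constructor
  · exact_mod_cast key1
  · exact_mod_cast key2

/-- ★★ **EVERY CUBE HAS A WELL-PLACED CHART**: for every cover cube `c` a chart `s` of the torus in which every site of `□̃(c)` has translated labels `t` with `S ≤ 2t`,
`2t + S ≤ 2N₀` — below the top level p38's canonical chart `s_μ = β_μ ∕ L^{k−j(c)} − 2` (centre in `[2S_k + S∕2, 3S_k − S∕2]`, `S_k ≥ 5S`, `P′ ≥ 5`); for a top cube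
`s_μ = β_μ − ⌊P′_μ∕2⌋` (`P′_μ ≥ 10` by `ten_le_P_of_top`). [cite: Balaban1984PropagatorsII, p.238 (T_□), p.229, (2.36); Balaban1985BackgroundPropagators, p.408 (□̃); bookkeeping] -/
theorem exists_chart_central : ∃ s : Fin (d + 1) → ℤ, ∀ xx : Site (PV d ℓ x.m x.K hd hL) 0, chartY x.toKIdx xx ∈ cubeDomY x c → ∀ μ,
    bigSide ℓ x.toKIdx.Mh c.1.1 ≤ 2 * ((xx - tv (PV d ℓ x.m x.K hd hL) (TDomains.tvec ℓ x.toKIdx.Mh x.toKIdx.k s) 0) μ).val ∧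
      2 * ((xx - tv (PV d ℓ x.m x.K hd hL) (TDomains.tvec ℓ x.toKIdx.Mh x.toKIdx.k s) 0) μ).val + bigSide ℓ x.toKIdx.Mh c.1.1 ≤
        2 * (PV d ℓ x.m x.K hd hL).sitesPerDir 0 := by
  have hjk : c.1.1 ≤ x.toKIdx.k := (level_bounds x.toKIdx.D.toDomains c).2
  have hS0 : (0 : ℝ) < (bigSide ℓ x.toKIdx.Mh c.1.1 : ℝ) := bigSide_pos x c.1.1
  have hP5 : ∀ μ, (5 : ℝ) ≤ (x.toKIdx.P' μ : ℝ) := fun μ => by exact_mod_cast x.toKIdx.hP5 μ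
  have hN : ∀ μ, (N0 ℓ x.toKIdx.Mh x.toKIdx.k x.toKIdx.P' μ : ℝ) = (bigSide ℓ x.toKIdx.Mh x.toKIdx.k : ℝ) * (x.toKIdx.P' μ : ℝ) := fun μ => by
    rw [N0_eq_bigSide_mul]; push_cast; rfl
  -- `S_k = S · L^{k−j(c)}`
  have hSk : (bigSide ℓ x.toKIdx.Mh x.toKIdx.k : ℝ) = (bigSide ℓ x.toKIdx.Mh c.1.1 : ℝ) * (rj ℓ x.toKIdx.k c.1.1 : ℝ) := by
    rw [bigSide_k_eq (Mh := x.toKIdx.Mh) hjk]; unfold bigSide; push_cast; ring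
  by_cases htop : c.1.1 = x.toKIdx.k
  · -- a TOP cube: centre re-placed at `(⌊P′∕2⌋ + ½)·S_k`
    have hr1 : (rj ℓ x.toKIdx.k c.1.1 : ℝ) = 1 := by unfold rj; rw [htop, Nat.sub_self, pow_zero]; push_cast; rfl
    rw [hr1, mul_one] at hSk
    obtain ⟨q, hq⟩ : ∃ q : Fin (d + 1) → ℕ, ∀ μ, q μ = x.toKIdx.P' μ / 2 := ⟨_, fun μ => rfl⟩
    refine ⟨fun μ => c.1.2 μ - (q μ : ℤ), fun xx hxx μ => ?_⟩
    refine central_of_chart x c _ (fun μ => (q μ : ℝ) * (bigSide ℓ x.toKIdx.Mh c.1.1 : ℝ)) (fun ν => ?_) (fun ν => ?_) (fun ν => ?_) hxx μ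
    · rw [hSk]; push_cast; ring
    · have h10 := ten_le_P_of_top x c htop ν
      have hq5 : (5 : ℝ) ≤ (q ν : ℝ) := by exact_mod_cast (show 5 ≤ q ν by rw [hq]; omega)
      nlinarith
    · have h10 := ten_le_P_of_top x c htop ν
      have hq5 : (q ν : ℝ) + 5 ≤ (x.toKIdx.P' ν : ℝ) := by exact_mod_cast (show q ν + 5 ≤ x.toKIdx.P' ν by rw [hq]; omega)
      rw [hN ν, hSk]
      nlinarith
  · -- below the top level: p38's canonical chart, centre in `[2S_k + S∕2, 3S_k − S∕2]`
    have hlt : c.1.1 < x.toKIdx.k := lt_of_le_of_ne hjk htop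
    have hr5 : (5 : ℝ) ≤ (rj ℓ x.toKIdx.k c.1.1 : ℝ) := by
      have h1 : (ℓ + 1) ^ 1 ≤ (ℓ + 1) ^ (x.toKIdx.k - c.1.1) := Nat.pow_le_pow_right (Nat.succ_pos ℓ) (by omega)
      have h2 : 5 ≤ ℓ + 1 := by have := x.toKIdx.hℓ; omega
      have : 5 ≤ rj ℓ x.toKIdx.k c.1.1 := by unfold rj; rw [pow_one] at h1; omega
      exact_mod_cast this
    have hr0 : (0 : ℤ) < (rj ℓ x.toKIdx.k c.1.1 : ℤ) := by exact_mod_cast one_le_rj (ℓ := ℓ) (k := x.toKIdx.k) c.1.1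
    refine ⟨fun μ => c.1.2 μ / (rj ℓ x.toKIdx.k c.1.1 : ℤ) - 2, fun xx hxx μ => ?_⟩
    refine central_of_chart x c _
      (fun μ => ((c.1.2 μ % (rj ℓ x.toKIdx.k c.1.1 : ℤ) : ℤ) : ℝ) * (bigSide ℓ x.toKIdx.Mh c.1.1 : ℝ) + 2 * (bigSide ℓ x.toKIdx.Mh x.toKIdx.k : ℝ))
      (fun ν => ?_) (fun ν => ?_) (fun ν => ?_) hxx μ
    · -- `(β + ½)S − S_k(β∕r − 2) = (β mod r)S + 2S_k + S∕2`
      have hdiv : ((c.1.2 ν % (rj ℓ x.toKIdx.k c.1.1 : ℤ) : ℤ) : ℝ) =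
          (c.1.2 ν : ℝ) - (rj ℓ x.toKIdx.k c.1.1 : ℝ) * ((c.1.2 ν / (rj ℓ x.toKIdx.k c.1.1 : ℤ) : ℤ) : ℝ) := by
        have e := Int.emod_def (c.1.2 ν) (rj ℓ x.toKIdx.k c.1.1 : ℤ)
        have := congrArg (fun z : ℤ => (z : ℝ)) e
        push_cast at this
        linarith
      rw [hdiv, hSk]; push_cast; ring
    · have hmod0 : (0 : ℝ) ≤ ((c.1.2 ν % (rj ℓ x.toKIdx.k c.1.1 : ℤ) : ℤ) : ℝ) := by exact_mod_cast Int.emod_nonneg _ hr0.ne'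
      rw [hSk]; nlinarith
    · have hmod1 : ((c.1.2 ν % (rj ℓ x.toKIdx.k c.1.1 : ℤ) : ℤ) : ℝ) + 1 ≤ (rj ℓ x.toKIdx.k c.1.1 : ℝ) := by
        have := Int.emod_lt_of_pos (c.1.2 ν) hr0
        have h' : c.1.2 ν % (rj ℓ x.toKIdx.k c.1.1 : ℤ) + 1 ≤ (rj ℓ x.toKIdx.k c.1.1 : ℤ) := by omega
        exact_mod_cast h'
      rw [hN ν, hSk]
      have hP := hP5 ν
      nlinarith [mul_le_mul_of_nonneg_left hP (le_of_lt (mul_pos hS0 (by linarith : (0 : ℝ) < (rj ℓ x.toKIdx.k c.1.1 : ℝ))))]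

/-! ## §3 The margins of the chart road from the central placement -/

/-- ★★ **CENTRAL PLACEMENT ⇒ THE LABEL MARGINS OF THE CHART ROAD.**  If every site of `□̃(c)` has translated labels in `[S∕2, N₀ − S∕2]` in the chart `s`, then at each
candidate level `j ∈ {j(c)−1, j(c)}` (so `8L^{j+1} ≤ S`): the translated `Λ_j`-blocks meeting `□̃(c)` are one big block off the box boundary (`hmargS` of
`local_lemma24_real_twoLevel_of_lev_chart`), and so are the translated `Λ_{j+1}`-blocks equal or adjacent to a big block meeting `□̃(c)` (`hmargT`).
[cite: Balaban1984PropagatorsII, p.238 (T_□), (2.89) p.239, (2.36) p.229; Balaban1985BackgroundPropagators, p.408 (□̃); bookkeeping] -/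
theorem margins_of_central {j : ℕ} (hjk : j + 1 ≤ x.toKIdx.k) (hjc : j = c.1.1 ∨ j + 1 = c.1.1) {s : Fin (d + 1) → ℤ}
    (hcen : ∀ xx : Site (PV d ℓ x.m x.K hd hL) 0, chartY x.toKIdx xx ∈ cubeDomY x c → ∀ μ,
      bigSide ℓ x.toKIdx.Mh c.1.1 ≤ 2 * ((xx - tv (PV d ℓ x.m x.K hd hL) (TDomains.tvec ℓ x.toKIdx.Mh x.toKIdx.k s) 0) μ).val ∧
        2 * ((xx - tv (PV d ℓ x.m x.K hd hL) (TDomains.tvec ℓ x.toKIdx.Mh x.toKIdx.k s) 0) μ).val + bigSide ℓ x.toKIdx.Mh c.1.1 ≤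
          2 * (PV d ℓ x.m x.K hd hL).sitesPerDir 0) :
    (∀ y : Site (PV d ℓ x.m x.K hd hL) j, (domT x.toKIdx.hN x.toKIdx.D x.toKIdx.hk).LamSite j y →
      (∃ y' ∈ iterBlock j y, chartY x.toKIdx y' ∈ cubeDomY x c) →
      ∀ μ, (ℓ + 1) ^ (j + 1) ≤ ((y - tv (PV d ℓ x.m x.K hd hL) (TDomains.tvec ℓ x.toKIdx.Mh x.toKIdx.k s) j) μ).val * (ℓ + 1) ^ j ∧
        ((y - tv (PV d ℓ x.m x.K hd hL) (TDomains.tvec ℓ x.toKIdx.Mh x.toKIdx.k s) j) μ).val * (ℓ + 1) ^ j + (ℓ + 1) ^ j + (ℓ + 1) ^ (j + 1) ≤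
          (PV d ℓ x.m x.K hd hL).sitesPerDir 0) ∧
    (∀ Y : Site (PV d ℓ x.m x.K hd hL) (j + 1), (domT x.toKIdx.hN x.toKIdx.D x.toKIdx.hk).LamSite (j + 1) Y →
      (∃ Y₀ : Site (PV d ℓ x.m x.K hd hL) (j + 1), (∃ y : Site (PV d ℓ x.m x.K hd hL) 0, iterBlockOf (j + 1) y = Y₀ ∧ chartY x.toKIdx y ∈ cubeDomY x c) ∧
        (Y = Y₀ ∨ ∃ μ, Y = Y₀.shift μ ∨ Y₀ = Y.shift μ)) →
      ∀ μ, (ℓ + 1) ^ (j + 1) ≤ ((Y - tv (PV d ℓ x.m x.K hd hL) (TDomains.tvec ℓ x.toKIdx.Mh x.toKIdx.k s) (j + 1)) μ).val * (ℓ + 1) ^ (j + 1) ∧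
        ((Y - tv (PV d ℓ x.m x.K hd hL) (TDomains.tvec ℓ x.toKIdx.Mh x.toKIdx.k s) (j + 1)) μ).val * (ℓ + 1) ^ (j + 1) + 2 * (ℓ + 1) ^ (j + 1) ≤
          (PV d ℓ x.m x.K hd hL).sitesPerDir 0) := by
  have hjm : j + 1 ≤ x.m + x.K := hjk.trans x.toKIdx.hk
  have hjm0 : j ≤ x.m + x.K := (Nat.le_succ j).trans hjm
  have hvj : ∀ μ, ((ℓ + 1 : ℕ) : ℤ) ^ j ∣ TDomains.tvec ℓ x.toKIdx.Mh x.toKIdx.k s μ := fun μ =>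
    dvd_tvec (hd := hd) (hL := hL) (m := x.m) (K := x.K) (by omega) s μ
  have hvJ : ∀ μ, ((ℓ + 1 : ℕ) : ℤ) ^ (j + 1) ∣ TDomains.tvec ℓ x.toKIdx.Mh x.toKIdx.k s μ := fun μ =>
    dvd_tvec (hd := hd) (hL := hL) (m := x.m) (K := x.K) (by omega) s μ
  have h8j : 8 * (ℓ + 1) ^ j ≤ bigSide ℓ x.toKIdx.Mh c.1.1 := eight_pow_le_bigSide x c (by omega)
  have h8J : 8 * (ℓ + 1) ^ (j + 1) ≤ bigSide ℓ x.toKIdx.Mh c.1.1 := eight_pow_le_bigSide x c (by omega)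
  have hLJ : 0 < (ℓ + 1) ^ (j + 1) := pow_pos (Nat.succ_pos ℓ) _
  constructor
  · intro y _ ⟨y', hy', hD⟩ μ
    obtain ⟨h1, h2⟩ := hcen y' hD μ
    obtain ⟨hb1, hb2⟩ := val_mul_pow_le_of_mem_iterBlock x hjm0 (sub_tv_mem_iterBlock x hjm0 hvj hy') μ
    constructor
    · linarith
    · linarith
  · intro Y _ ⟨Y₀, ⟨y, hy, hD⟩, hadj⟩ μ
    obtain ⟨h1, h2⟩ := hcen y hD μ
    have hyY : y ∈ iterBlock (j + 1) Y₀ := (mem_iterBlock _ _ _).2 hy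
    obtain ⟨hb1, hb2⟩ := val_mul_pow_le_of_mem_iterBlock x hjm (sub_tv_mem_iterBlock x hjm hvJ hyY) μ
    obtain ⟨Y₀', hY₀'⟩ : ∃ n : ℕ, ((Y₀ - tv (PV d ℓ x.m x.K hd hL) (TDomains.tvec ℓ x.toKIdx.Mh x.toKIdx.k s) (j + 1)) μ).val = n := ⟨_, rfl⟩
    rw [hY₀'] at hb1 hb2
    -- the translated label of `Y₀` is `≥ 3` and `≤ N_{j+1} − 4`
    have hN : (PV d ℓ x.m x.K hd hL).sitesPerDir 0 = (PV d ℓ x.m x.K hd hL).sitesPerDir (j + 1) * (ℓ + 1) ^ (j + 1) :=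
      sitesPerDir_zero_eq_mul' x hjm
    have hlow : 3 ≤ Y₀' := by
      by_contra hlt
      push Not at hlt
      have : Y₀' * (ℓ + 1) ^ (j + 1) ≤ 2 * (ℓ + 1) ^ (j + 1) := Nat.mul_le_mul_right _ (by omega)
      linarith
    have hhigh : Y₀' + 4 ≤ (PV d ℓ x.m x.K hd hL).sitesPerDir (j + 1) := by
      by_contra hlt
      push Not at hlt
      have hle : (PV d ℓ x.m x.K hd hL).sitesPerDir (j + 1) * (ℓ + 1) ^ (j + 1) ≤ (Y₀' + 3) * (ℓ + 1) ^ (j + 1) :=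
        Nat.mul_le_mul_right _ (by omega)
      have h2' : 2 * ((y - tv (PV d ℓ x.m x.K hd hL) (TDomains.tvec ℓ x.toKIdx.Mh x.toKIdx.k s) 0) μ).val + bigSide ℓ x.toKIdx.Mh c.1.1 ≤
          2 * ((PV d ℓ x.m x.K hd hL).sitesPerDir (j + 1) * (ℓ + 1) ^ (j + 1)) := by rw [← hN]; exact h2
      nlinarith [hle, h2', hb1, h8J, hLJ]
    -- the translated label of `Y` is `Y₀'`, `Y₀' + 1` or `Y₀' − 1`
    have hone : (1 : ZMod ((PV d ℓ x.m x.K hd hL).sitesPerDir (j + 1))).val = 1 := by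
      rw [ZMod.val_one_eq_one_mod, Nat.mod_eq_of_lt (by omega)]
    have hval : ((Y - tv (PV d ℓ x.m x.K hd hL) (TDomains.tvec ℓ x.toKIdx.Mh x.toKIdx.k s) (j + 1)) μ).val = Y₀' ∨
        ((Y - tv (PV d ℓ x.m x.K hd hL) (TDomains.tvec ℓ x.toKIdx.Mh x.toKIdx.k s) (j + 1)) μ).val = Y₀' + 1 ∨
        ((Y - tv (PV d ℓ x.m x.K hd hL) (TDomains.tvec ℓ x.toKIdx.Mh x.toKIdx.k s) (j + 1)) μ).val + 1 = Y₀' := by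
      rcases hadj with rfl | ⟨ν, rfl | hY⟩
      · exact Or.inl hY₀'
      · by_cases hνμ : μ = ν
        · subst hνμ
          right; left
          have e : (Y₀.shift μ - tv (PV d ℓ x.m x.K hd hL) (TDomains.tvec ℓ x.toKIdx.Mh x.toKIdx.k s) (j + 1)) μ =
              (Y₀ - tv (PV d ℓ x.m x.K hd hL) (TDomains.tvec ℓ x.toKIdx.Mh x.toKIdx.k s) (j + 1)) μ + 1 := by
            rw [site_sub_apply, site_sub_apply]; simp only [Site.shift, Function.update_self]; ring
          rw [e, ZMod.val_add_of_lt (by rw [hone, hY₀']; omega), hone, hY₀']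
        · left
          have e : (Y₀.shift ν - tv (PV d ℓ x.m x.K hd hL) (TDomains.tvec ℓ x.toKIdx.Mh x.toKIdx.k s) (j + 1)) μ =
              (Y₀ - tv (PV d ℓ x.m x.K hd hL) (TDomains.tvec ℓ x.toKIdx.Mh x.toKIdx.k s) (j + 1)) μ := by
            rw [site_sub_apply, site_sub_apply]; simp only [Site.shift, Function.update_of_ne hνμ]
          rw [e, hY₀']
      · by_cases hνμ : μ = ν
        · subst hνμ
          right; right
          have e : (Y - tv (PV d ℓ x.m x.K hd hL) (TDomains.tvec ℓ x.toKIdx.Mh x.toKIdx.k s) (j + 1)) μ =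
              (Y₀ - tv (PV d ℓ x.m x.K hd hL) (TDomains.tvec ℓ x.toKIdx.Mh x.toKIdx.k s) (j + 1)) μ - 1 := by
            rw [hY, site_sub_apply, site_sub_apply]; simp only [Site.shift, Function.update_self]; ring
          rw [e, ZMod.val_sub (by rw [hone, hY₀']; omega), hone, hY₀']
          omega
        · left
          have e : (Y - tv (PV d ℓ x.m x.K hd hL) (TDomains.tvec ℓ x.toKIdx.Mh x.toKIdx.k s) (j + 1)) μ =
              (Y₀ - tv (PV d ℓ x.m x.K hd hL) (TDomains.tvec ℓ x.toKIdx.Mh x.toKIdx.k s) (j + 1)) μ := by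
            rw [hY, site_sub_apply, site_sub_apply]; simp only [Site.shift, Function.update_of_ne hνμ]
          rw [e, hY₀']
    rcases hval with h | h | h
    · rw [h]
      exact ⟨Nat.le_mul_of_pos_left _ (by omega), by linarith⟩
    · rw [h]
      exact ⟨Nat.le_mul_of_pos_left _ (by omega), by nlinarith [hb1, h2, h8J]⟩
    · obtain ⟨Y₁, rfl⟩ : ∃ Y₁, Y₀' = Y₁ + 1 := ⟨Y₀' - 1, by omega⟩
      have hv : ((Y - tv (PV d ℓ x.m x.K hd hL) (TDomains.tvec ℓ x.toKIdx.Mh x.toKIdx.k s) (j + 1)) μ).val = Y₁ := by omega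
      rw [hv]
      exact ⟨Nat.le_mul_of_pos_left _ (by omega), by nlinarith [hb1, h2, h8J]⟩

/-- ★★★ **EVERY ENLARGED CUBE `□̃(c)` SITS ONE BIG BLOCK OFF THE SEAM IN A SUITABLE CHART — THE LABEL MARGINS OF ROW 17's LOCAL ROAD DISCHARGED.**  For EVERY member `x`,
EVERY cover cube `c` and every candidate level `j` (`j + 1 ≤ k`, `j = j(c) ∨ j + 1 = j(c)`) there is a chart `s` of the torus (translation by `(M·L^k)·s`) such that
(`hmargS`) every `Λ_j`-block whose block meets `□̃(c)` and (`hmargT`) every `Λ_{j+1}`-block equal or adjacent to a big block meeting `□̃(c)` has TRANSLATED labels one big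
block off the box boundary — verbatim the binder shapes of `B9LocalLemma24TwoLevelCollarChartY.local_lemma24_real_twoLevel_of_lev_chart` at `D := cubeDomY x c`
(`exists_chart_central` ∘ `margins_of_central`). [cite: Balaban1984PropagatorsII, p.238 («identify it with a torus T_□»), (2.89) p.239, p.229, (2.36); Balaban1985BackgroundPropagators, p.408 (□̃), Thm 3.11 proof p.416] -/
theorem exists_chart_margins_cubeDomY {j : ℕ} (hjk : j + 1 ≤ x.toKIdx.k) (hjc : j = c.1.1 ∨ j + 1 = c.1.1) :
    ∃ s : Fin (d + 1) → ℤ,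
    (∀ y : Site (PV d ℓ x.m x.K hd hL) j, (domT x.toKIdx.hN x.toKIdx.D x.toKIdx.hk).LamSite j y →
      (∃ y' ∈ iterBlock j y, chartY x.toKIdx y' ∈ cubeDomY x c) →
      ∀ μ, (ℓ + 1) ^ (j + 1) ≤ ((y - tv (PV d ℓ x.m x.K hd hL) (TDomains.tvec ℓ x.toKIdx.Mh x.toKIdx.k s) j) μ).val * (ℓ + 1) ^ j ∧
        ((y - tv (PV d ℓ x.m x.K hd hL) (TDomains.tvec ℓ x.toKIdx.Mh x.toKIdx.k s) j) μ).val * (ℓ + 1) ^ j + (ℓ + 1) ^ j + (ℓ + 1) ^ (j + 1) ≤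
          (PV d ℓ x.m x.K hd hL).sitesPerDir 0) ∧
    (∀ Y : Site (PV d ℓ x.m x.K hd hL) (j + 1), (domT x.toKIdx.hN x.toKIdx.D x.toKIdx.hk).LamSite (j + 1) Y →
      (∃ Y₀ : Site (PV d ℓ x.m x.K hd hL) (j + 1), (∃ y : Site (PV d ℓ x.m x.K hd hL) 0, iterBlockOf (j + 1) y = Y₀ ∧ chartY x.toKIdx y ∈ cubeDomY x c) ∧
        (Y = Y₀ ∨ ∃ μ, Y = Y₀.shift μ ∨ Y₀ = Y.shift μ)) →
      ∀ μ, (ℓ + 1) ^ (j + 1) ≤ ((Y - tv (PV d ℓ x.m x.K hd hL) (TDomains.tvec ℓ x.toKIdx.Mh x.toKIdx.k s) (j + 1)) μ).val * (ℓ + 1) ^ (j + 1) ∧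
        ((Y - tv (PV d ℓ x.m x.K hd hL) (TDomains.tvec ℓ x.toKIdx.Mh x.toKIdx.k s) (j + 1)) μ).val * (ℓ + 1) ^ (j + 1) + 2 * (ℓ + 1) ^ (j + 1) ≤
          (PV d ℓ x.m x.K hd hL).sitesPerDir 0) := by
  obtain ⟨s, hs⟩ := exists_chart_central x c
  exact ⟨s, margins_of_central x c hjk hjc hs⟩

end Literature.MathematicalPhysics.QuantumFieldTheory.Balaban1983to89.B9LocalCubeGeometryChartY

end
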